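import Mathlib.Analysis.Complex.ExponentialBounds
import Literature.NumberTheory.Transcendental.RoyCriterion
import HarnessLib

/-!
# Ably's measure of algebraic independence for `e^{y₁}, …, e^{yₙ}` — §III: arithmetic of the parameters

`Literature/NumberTheory/Transcendental/LWMeasureTheoremArith.lean` — proofs only (no
definitions, no named facts, nothing asserted). Real-arithmetic bookkeeping for the last step
("§III. Preuve du théorème", pp. 42–44) of M. Ably, *Une version quantitative du théorème de
Lindemann–Weierstrass*, Acta Arith. 67 (1994) 29–45, behind the named fact
`Ably1994_lindemannWeierstrass_measure` (`LindemannWeierstrassMeasure.lean`), as carried out in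
`LWMeasureTheorem.lean` (`LWMeasure.ably1994_of_criterion_of_mainProp`): with the criterion's
constant `C`, its factors `K, q` (at `σ = 2`) and the main proposition's constants
`M₀, c_E, c_δ, c_τ`, the parameters are (for `P` of degree `≤ D`, `D ≥ 1`, and height `≤ H`)

* `A = 2 C K q^k (c_δ+1)^{k+1}`, `M = M₀ + ⌈A c_τ D⌉ + ⌈c_τ⌉ + 4` (`thmIII_arith_M`),
* `δ = (c_δ+1) M`, `U = A M^{k+1}(D + log H) + M^{k+1} e^{c_E M^{k+1} log M}/c_τ
  + 2(k+2)(c_δ+1)M^{k+2}/c_τ + 1`, `τ = c_τ U / M^{k+1}` — the criterion's side conditions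
  `δ ≥ 1`, `2(k+2)δ ≤ τ < U`, `e^{c_E M^{k+1} log M} ≤ τ` (`thmIII_arith_params`) and its budget
  `C K (qδ)^k (δ(deg P + log H(P)) + τ deg P) ≤ U` (`thmIII_arith_cond`),
* the final size `U ≤ c₂ D^{k+1} (log H + exp(C₀ D^{k+1} log(D+1)))` with `C₀, c₂` depending on
  `A, M₀, c_E, c_δ, c_τ, k` only (`thmIII_arith_final`),

(`n = k + 1` exponentials, point `(α, e^{y}) ∈ ℂ^{k+2}`), together with two bookkeeping facts on
reading `P ∈ ℤ[X₁, …, Xₙ]` in `ℤ[w, X₁, …, Xₙ]` along an injective renaming (total degree and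
naive height are unchanged / not increased).

## References

* [Ably1994] M. Ably, *Une version quantitative du théorème de Lindemann–Weierstrass*, Acta Arith.
  67 (1994) 29–45, §III Preuve du théorème (pp. 42–44).
-/

noncomputable section

open MvPolynomial

namespace Literature.NumberTheory.Transcendental

namespace LWMeasure

/-! ### Real-arithmetic bookkeeping for the choice of parameters (Ably 1994, §III) -/

/-- The integer parameter `M = M₀ + ⌈A c_τ D⌉ + ⌈c_τ⌉ + 4`: `M ≥ M₀`, `M ≥ c_τ + 1`,
`M ≥ A c_τ D` and `M ≤ (M₀ + A c_τ + c_τ + 6) D` for `D ≥ 1`. [folklore] -/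
theorem thmIII_arith_M {A cτ D : ℝ} {M₀ M : ℕ} (hA : 0 ≤ A) (hcτ : 0 < cτ) (hD : 1 ≤ D)
    (hM : M = M₀ + ⌈A * cτ * D⌉₊ + ⌈cτ⌉₊ + 4) :
    M₀ ≤ M ∧ cτ + 1 ≤ (M : ℝ) ∧ A * cτ * D ≤ (M : ℝ) ∧
      (M : ℝ) ≤ ((M₀ : ℝ) + A * cτ + cτ + 6) * D := by
  have hD0 : 0 < D := by linarith
  have hMr : (M : ℝ) = M₀ + (⌈A * cτ * D⌉₊ : ℝ) + (⌈cτ⌉₊ : ℝ) + 4 := by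
    rw [hM]; push_cast; ring
  have h1 : A * cτ * D ≤ (⌈A * cτ * D⌉₊ : ℝ) := Nat.le_ceil _
  have h2 : cτ ≤ (⌈cτ⌉₊ : ℝ) := Nat.le_ceil _
  have h3 : (⌈A * cτ * D⌉₊ : ℝ) < A * cτ * D + 1 := Nat.ceil_lt_add_one (by positivity)
  have h4 : (⌈cτ⌉₊ : ℝ) < cτ + 1 := Nat.ceil_lt_add_one hcτ.le
  have hM₀ : (0 : ℝ) ≤ M₀ := Nat.cast_nonneg _
  have hc0 : (0 : ℝ) ≤ (⌈A * cτ * D⌉₊ : ℝ) := Nat.cast_nonneg _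
  refine ⟨by rw [hM]; omega, by linarith, by linarith, ?_⟩
  rw [hMr]
  have : (M₀ : ℝ) + cτ + 6 ≤ ((M₀ : ℝ) + cτ + 6) * D :=
    le_mul_of_one_le_right (by positivity) hD
  linarith

/-- The parameter conditions of the criterion at `δ = (c_δ+1)M`, `τ = c_τ U / M^{k+1}`,
`U = T + M^{k+1} R_min / c_τ + 2(k+2)(c_δ+1) M^{k+2}/c_τ + 1` (`T ≥ 0`, `M ≥ c_τ + 1`):
`δ ≥ 1`, `2(k+2)δ ≤ τ`, `τ < U`, `R_min ≤ τ`, `U > 0`. [folklore] -/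
theorem thmIII_arith_params {k : ℕ} {cδ cτ M Rm U T : ℝ} (hcδ : 0 ≤ cδ) (hcτ : 0 < cτ)
    (hM : cτ + 1 ≤ M) (hRm : 0 ≤ Rm) (hT : 0 ≤ T)
    (hU : U = T + M ^ (k + 1) * Rm / cτ +
      2 * ((k + 1 + 1 : ℕ) : ℝ) * (cδ + 1) * M ^ (k + 1 + 1) / cτ + 1) :
    1 ≤ (cδ + 1) * M ∧
      2 * ((k + 1 + 1 : ℕ) : ℝ) * ((cδ + 1) * M) ≤ cτ * U / M ^ (k + 1) ∧
      cτ * U / M ^ (k + 1) < U ∧ Rm ≤ cτ * U / M ^ (k + 1) ∧ 0 < U := by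
  have hM1 : 1 ≤ M := by linarith
  have hM0 : 0 < M := by linarith
  have hpow : 0 < M ^ (k + 1) := by positivity
  have hA2 : 0 ≤ M ^ (k + 1) * Rm / cτ := by positivity
  have hA3 : 0 ≤ 2 * ((k + 1 + 1 : ℕ) : ℝ) * (cδ + 1) * M ^ (k + 1 + 1) / cτ := by positivity
  have hU1 : 1 ≤ U := by rw [hU]; linarith
  refine ⟨?_, ?_, ?_, ?_, by linarith⟩
  · nlinarith
  · rw [le_div_iff₀ hpow]
    have h3 : 2 * ((k + 1 + 1 : ℕ) : ℝ) * (cδ + 1) * M ^ (k + 1 + 1) / cτ ≤ U := by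
      rw [hU]; linarith
    rw [div_le_iff₀ hcτ, pow_succ] at h3
    linarith
  · rw [div_lt_iff₀ hpow]
    have hcM : cτ < M ^ (k + 1) :=
      lt_of_lt_of_le (by linarith) (le_self_pow₀ hM1 (Nat.succ_ne_zero k))
    nlinarith [mul_lt_mul_of_pos_left hcM (by linarith : (0 : ℝ) < U)]
  · rw [le_div_iff₀ hpow]
    have h2 : M ^ (k + 1) * Rm / cτ ≤ U := by rw [hU]; linarith
    rw [div_le_iff₀ hcτ] at h2
    linarith

/-- The criterion's budget at the chosen parameters: with `δ = (c_δ+1)M`, `τ = c_τ U / M^{k+1}`,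
`A = 2 C K q^k (c_δ+1)^{k+1}`, `A c_τ D ≤ M` and `A M^{k+1} (D + log H) ≤ U`, one has
`C K (qδ)^k (δ (D' + L') + τ D') ≤ U` whenever `0 ≤ D' ≤ D`, `L' ≤ log H`. [folklore] -/
theorem thmIII_arith_cond {k : ℕ} {A C K q cδ cτ M D L D' L' U : ℝ}
    (hA : A = 2 * C * K * q ^ k * (cδ + 1) ^ (k + 1)) (hC : 0 ≤ C) (hK : 0 ≤ K) (hq : 0 ≤ q)
    (hcδ : 0 ≤ cδ) (hcτ : 0 ≤ cτ) (hM : 0 < M) (hMD : A * cτ * D ≤ M) (hD'0 : 0 ≤ D')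
    (hD' : D' ≤ D) (hL' : L' ≤ L) (hU0 : 0 ≤ U) (hU : A * M ^ (k + 1) * (D + L) ≤ U) :
    C * K * (q * ((cδ + 1) * M)) ^ k *
        ((cδ + 1) * M * (D' + L') + cτ * U / M ^ (k + 1) * D') ≤ U := by
  have hD0 : 0 ≤ D := hD'0.trans hD'
  have h1 : (cδ + 1) * M * (D' + L') + cτ * U / M ^ (k + 1) * D' ≤
      (cδ + 1) * M * (D + L) + cτ * U / M ^ (k + 1) * D := by
    gcongr
  have hI : C * K * q ^ k * (cδ + 1) ^ (k + 1) * M ^ (k + 1) * (D + L) ≤ U / 2 := by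
    rw [hA] at hU; linarith
  have h5 : 2 * C * K * q ^ k * (cδ + 1) ^ k * cτ * D ≤ M := by
    refine le_trans ?_ (hA ▸ hMD)
    have h1c : (1 : ℝ) ≤ cδ + 1 := by linarith
    gcongr
    exact Nat.le_succ k
  have hII : C * K * q ^ k * (cδ + 1) ^ k * M ^ k * (cτ * U / M ^ (k + 1)) * D ≤ U / 2 := by
    rw [show C * K * q ^ k * (cδ + 1) ^ k * M ^ k * (cτ * U / M ^ (k + 1)) * D =
        C * K * q ^ k * (cδ + 1) ^ k * M ^ k * cτ * U * D / M ^ (k + 1) by ring,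
      div_le_iff₀ (by positivity), pow_succ]
    have := mul_le_mul_of_nonneg_right h5 (by positivity : (0 : ℝ) ≤ M ^ k * U)
    nlinarith
  calc C * K * (q * ((cδ + 1) * M)) ^ k *
        ((cδ + 1) * M * (D' + L') + cτ * U / M ^ (k + 1) * D')
      ≤ C * K * (q * ((cδ + 1) * M)) ^ k *
          ((cδ + 1) * M * (D + L) + cτ * U / M ^ (k + 1) * D) :=
        mul_le_mul_of_nonneg_left h1 (by positivity)
    _ = C * K * q ^ k * (cδ + 1) ^ (k + 1) * M ^ (k + 1) * (D + L) +
          C * K * q ^ k * (cδ + 1) ^ k * M ^ k * (cτ * U / M ^ (k + 1)) * D := by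
        rw [mul_pow, mul_pow]; ring
    _ ≤ U / 2 + U / 2 := add_le_add hI hII
    _ = U := by ring

/-- The size of `U` at the chosen parameters: for `6 ≤ B`, `1 ≤ M ≤ B D`, `D ≥ 1`, `log H ≥ 0`,
`A M^{k+1}(D + log H) + M^{k+1} e^{c_E M^{k+1} log M}/c_τ + 2(k+2)(c_δ+1)M^{k+2}/c_τ + 1
  ≤ c₂ D^{k+1} (log H + exp(C₀ D^{k+1} log(D+1)))`
with `C₀ = c_E B^{k+1}(2 log B + 1) + 1`,
`c₂ = A B^{k+1} + B^{k+1}/c_τ + 2(k+2)(c_δ+1)B^{k+2}/c_τ + 1`. [folklore] -/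
theorem thmIII_arith_final {k : ℕ} {A B cE cδ cτ M D LH : ℝ} (hA : 0 ≤ A) (hB : 6 ≤ B)
    (hcE : 0 ≤ cE) (hcδ : 0 ≤ cδ) (hcτ : 0 < cτ) (hD : 1 ≤ D) (hLH : 0 ≤ LH) (hM1 : 1 ≤ M)
    (hMB : M ≤ B * D) :
    A * M ^ (k + 1) * (D + LH) + M ^ (k + 1) * Real.exp (cE * M ^ (k + 1) * Real.log M) / cτ +
        2 * ((k + 1 + 1 : ℕ) : ℝ) * (cδ + 1) * M ^ (k + 1 + 1) / cτ + 1 ≤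
      (A * B ^ (k + 1) + B ^ (k + 1) / cτ +
          2 * ((k + 1 + 1 : ℕ) : ℝ) * (cδ + 1) * B ^ (k + 1 + 1) / cτ + 1) * D ^ (k + 1) *
        (LH + Real.exp ((cE * B ^ (k + 1) * (2 * Real.log B + 1) + 1) * D ^ (k + 1) *
          Real.log (D + 1))) := by
  set L := Real.log (D + 1) with hL
  set C₀ := cE * B ^ (k + 1) * (2 * Real.log B + 1) + 1 with hC₀
  set E := Real.exp (C₀ * D ^ (k + 1) * L) with hE
  have hD0 : 0 < D := by linarith
  have hB1 : 1 ≤ B := by linarith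
  have hB0 : 0 ≤ B := by linarith
  have hlogB : 0 ≤ Real.log B := Real.log_nonneg hB1
  have hL2 : Real.log 2 ≤ L := Real.log_le_log two_pos (by linarith)
  have hL0 : 1 / 2 < L := by have := Real.log_two_gt_d9; linarith
  have hL0' : 0 ≤ L := by linarith
  have hDk : 1 ≤ D ^ (k + 1) := one_le_pow₀ hD
  have hC₀1 : 1 ≤ C₀ := by
    have : 0 ≤ cE * B ^ (k + 1) * (2 * Real.log B + 1) := by positivity
    linarith
  -- `log M ≤ (2 log B + 1) log(D+1)`
  have hlogM0 : 0 ≤ Real.log M := Real.log_nonneg hM1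
  have hlogM : Real.log M ≤ (2 * Real.log B + 1) * L := by
    have h1 : Real.log M ≤ Real.log B + L := by
      calc Real.log M ≤ Real.log (B * D) := Real.log_le_log (by linarith) hMB
        _ = Real.log B + Real.log D := Real.log_mul (by linarith) hD0.ne'
        _ ≤ Real.log B + L := by
            have := Real.log_le_log hD0 (by linarith : D ≤ D + 1); linarith
    nlinarith [mul_nonneg hlogB (by linarith : (0 : ℝ) ≤ 2 * L - 1)]
  -- `M^{k+1} ≤ B^{k+1} D^{k+1}`
  have hMk : M ^ (k + 1) ≤ B ^ (k + 1) * D ^ (k + 1) := by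
    rw [← mul_pow]; exact pow_le_pow_left₀ (by linarith) hMB _
  -- `R_min ≤ E`
  have hRE : Real.exp (cE * M ^ (k + 1) * Real.log M) ≤ E := by
    refine Real.exp_le_exp.mpr ?_
    calc cE * M ^ (k + 1) * Real.log M
        ≤ cE * (B ^ (k + 1) * D ^ (k + 1)) * ((2 * Real.log B + 1) * L) :=
          mul_le_mul (mul_le_mul_of_nonneg_left hMk hcE) hlogM hlogM0 (by positivity)
      _ = (C₀ - 1) * (D ^ (k + 1) * L) := by rw [hC₀]; ring
      _ ≤ C₀ * (D ^ (k + 1) * L) :=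
          mul_le_mul_of_nonneg_right (by linarith) (mul_nonneg (by positivity) hL0')
      _ = C₀ * D ^ (k + 1) * L := by ring
  -- `D ≤ E`, `1 ≤ E`
  have hDE : D ≤ E := by
    calc D ≤ D + 1 := by linarith
      _ = Real.exp L := (Real.exp_log (by linarith)).symm
      _ ≤ E := Real.exp_le_exp.mpr (by
          have : 1 ≤ C₀ * D ^ (k + 1) := one_le_mul_of_one_le_of_one_le hC₀1 hDk
          nlinarith)
  have hE1 : 1 ≤ E := hD.trans hDE
  have hE0 : 0 ≤ E := by linarith
  -- the four terms against `X = D^{k+1} (log H + E)`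
  set X := D ^ (k + 1) * (LH + E) with hX
  have hX1 : 1 ≤ X := by rw [hX]; nlinarith
  have hT1 : A * M ^ (k + 1) * (D + LH) ≤ A * B ^ (k + 1) * X := by
    have : M ^ (k + 1) * (D + LH) ≤ B ^ (k + 1) * D ^ (k + 1) * (LH + E) :=
      mul_le_mul hMk (by linarith) (by positivity) (by positivity)
    calc A * M ^ (k + 1) * (D + LH) = A * (M ^ (k + 1) * (D + LH)) := by ring
      _ ≤ A * (B ^ (k + 1) * D ^ (k + 1) * (LH + E)) := mul_le_mul_of_nonneg_left this hA
      _ = A * B ^ (k + 1) * X := by rw [hX]; ring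
  have hT2 : M ^ (k + 1) * Real.exp (cE * M ^ (k + 1) * Real.log M) / cτ ≤
      B ^ (k + 1) / cτ * X := by
    rw [div_mul_eq_mul_div, div_le_div_iff_of_pos_right hcτ]
    calc M ^ (k + 1) * Real.exp (cE * M ^ (k + 1) * Real.log M)
        ≤ (B ^ (k + 1) * D ^ (k + 1)) * E :=
          mul_le_mul hMk hRE (Real.exp_pos _).le (by positivity)
      _ ≤ B ^ (k + 1) * X := by
          rw [hX]
          have : (0 : ℝ) ≤ B ^ (k + 1) * D ^ (k + 1) := by positivity
          nlinarith
  have hT3 : 2 * ((k + 1 + 1 : ℕ) : ℝ) * (cδ + 1) * M ^ (k + 1 + 1) / cτ ≤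
      2 * ((k + 1 + 1 : ℕ) : ℝ) * (cδ + 1) * B ^ (k + 1 + 1) / cτ * X := by
    rw [div_mul_eq_mul_div, div_le_div_iff_of_pos_right hcτ]
    have h1 : M ^ (k + 1 + 1) ≤ B ^ (k + 1 + 1) * (D ^ (k + 1) * D) := by
      rw [← pow_succ, ← mul_pow]; exact pow_le_pow_left₀ (by linarith) hMB _
    have h2 : D ^ (k + 1) * D ≤ X := by
      rw [hX]; exact mul_le_mul_of_nonneg_left (by linarith) (by positivity)
    calc 2 * ((k + 1 + 1 : ℕ) : ℝ) * (cδ + 1) * M ^ (k + 1 + 1)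
        ≤ 2 * ((k + 1 + 1 : ℕ) : ℝ) * (cδ + 1) * (B ^ (k + 1 + 1) * X) := by
          refine mul_le_mul_of_nonneg_left (h1.trans ?_) (by positivity)
          exact mul_le_mul_of_nonneg_left h2 (by positivity)
      _ = 2 * ((k + 1 + 1 : ℕ) : ℝ) * (cδ + 1) * B ^ (k + 1 + 1) * X := by ring
  calc A * M ^ (k + 1) * (D + LH) + M ^ (k + 1) * Real.exp (cE * M ^ (k + 1) * Real.log M) / cτ +
        2 * ((k + 1 + 1 : ℕ) : ℝ) * (cδ + 1) * M ^ (k + 1 + 1) / cτ + 1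
      ≤ A * B ^ (k + 1) * X + B ^ (k + 1) / cτ * X +
          2 * ((k + 1 + 1 : ℕ) : ℝ) * (cδ + 1) * B ^ (k + 1 + 1) / cτ * X + 1 * X := by
        linarith
    _ = (A * B ^ (k + 1) + B ^ (k + 1) / cτ +
          2 * ((k + 1 + 1 : ℕ) : ℝ) * (cδ + 1) * B ^ (k + 1 + 1) / cτ + 1) * X := by ring
    _ = _ := by rw [hX]; ring

/-! ### Reading `P ∈ ℤ[X₁, …, Xₙ]` in `ℤ[w, X₁, …, Xₙ]` -/

/-- Renaming the variables along an injection does not change the total degree. [folklore] -/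
theorem totalDegree_rename_of_injective {σ τ : Type*} {f : σ → τ}
    (hf : Function.Injective f) (P : MvPolynomial σ ℤ) :
    (rename f P).totalDegree = P.totalDegree := by
  classical
  refine le_antisymm (totalDegree_rename_le f P) (Finset.sup_le fun s hs => ?_)
  have hs' : Finsupp.mapDomain f s ∈ (rename f P).support := by
    rw [support_rename_of_injective hf]
    exact Finset.mem_image_of_mem _ hs
  have h := le_totalDegree hs'
  rwa [Finsupp.sum_mapDomain_index_inj hf] at h

/-- Renaming the variables along an injection keeps the coefficients bounded by `H`, hence the
naive height `≤ H`. [folklore] -/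
theorem mvPolyHeight_rename_le_of_injective {σ τ : Type*} {f : σ → τ} (hf : Function.Injective f)
    {P : MvPolynomial σ ℤ} {H : ℕ} (hH : ∀ m, |P.coeff m| ≤ (H : ℤ)) :
    mvPolyHeight (rename f P) ≤ H := by
  refine Finset.sup_le fun m _ => ?_
  have hm : |(rename f P).coeff m| ≤ (H : ℤ) := by
    by_cases h0 : (rename f P).coeff m = 0
    · rw [h0, abs_zero]; exact_mod_cast Nat.zero_le H
    · obtain ⟨u, rfl, -⟩ := coeff_rename_ne_zero f P m h0
      rw [coeff_rename_mapDomain f hf]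
      exact hH u
  rw [Int.abs_eq_natAbs] at hm
  exact_mod_cast hm

end LWMeasure

end Literature.NumberTheory.Transcendental

end
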